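import Literature.NumberTheory.LFunctions.ExplicitFormulaPsiChar
import Literature.NumberTheory.LFunctions.PerronFormulaPsi
import HarnessLib

/-!
# The truncated Perron formula for `ψ₀(x, χ)` (Montgomery–Vaughan Thm. 5.2, Cor. 5.3, proof of
# Thm. 12.10)

Topic `Literature/NumberTheory/LFunctions`. THEOREMS (everything proved). The first step of the
proof of the truncated explicit formula for `ψ(x, χ)` (Montgomery–Vaughan, *Multiplicative Number
Theory I*, Thm. 12.10, the named fact
`Literature.NumberTheory.LFunctions.truncatedExplicitFormula_psiChar` of `ExplicitFormulaPsiChar.lean`):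
Perron's formula with its remainder for `a_n = χ(n)Λ(n)`, `σ₀ = b = 1 + 1/log x`, arbitrary
`x > 1`, `T ≥ 1` and ANY Dirichlet character `χ` (no primitivity needed here),

  **`ψ₀(x, χ) = (1/2πi) ∫_{b−iT}^{b+iT} (−L'/L)(s, χ) x^s ds/s + R₁`,
  `R₁ ≪_c (log x) min(1, x/(T⟨x⟩)) + (x/T)(log x)²`**   (`x ≥ c > 1`),

with an implied constant depending on `c` only — NOT on `q` or `χ`: the coefficients satisfy
`|χ(n)Λ(n)| ≤ Λ(n)`, so the majorants of the zeta case
(`Literature.NumberTheory.LFunctions.PerronPsi.perron_chebyshevPsi₀`, `PerronFormulaPsi.lean`, whose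
kernel estimates and elementary sums are reused verbatim) apply unchanged. MV p. 404: "we apply
Perron's formula as in the proof of Theorem 12.5". Here `ψ₀(x, χ) = chebyshevPsiChar₀ χ x`,
`⟨x⟩ = primePowDist x`, and `−L'/L = −logDeriv L(·, χ)`.

## References

* H. L. Montgomery, R. C. Vaughan, *Multiplicative Number Theory I. Classical Theory*, CUP 2007,
  §5.1 Thm. 5.2, Cor. 5.3; §12.1, proofs of Thm. 12.5 and Thm. 12.10. [MontgomeryVaughan2007]
-/

noncomputable section

open Complex Set MeasureTheory Filter Topology intervalIntegral Real
open ArithmeticFunction hiding log id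
open scoped Chebyshev Interval

namespace Literature.NumberTheory.LFunctions

namespace ExplicitPsiChar

open Literature.NumberTheory.Sieve (chebyshevPsiChar)
open PerronPsi

variable {q : ℕ} [NeZero q]

/-! ### `−L'/L(s, χ) x^s/s = ∑ χ(n)Λ(n) (x/n)^s/s` on `Re s > 1` -/

/-- **The Dirichlet series of `χΛ` against the Perron kernel.** For `x > 0` and `Re s > 1`,
`∑_n χ(n)Λ(n) (x/n)^s/s = (−L'/L)(s, χ) · x^s/s` (Mathlib's
`DirichletCharacter.LSeries_twist_vonMangoldt_eq`). [folklore] -/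
theorem hasSum_twist_vonMangoldt_mul_cpow_div (χ : DirichletCharacter ℂ q) {x : ℝ} (hx : 0 < x)
    {s : ℂ} (hs : 1 < s.re) :
    HasSum (fun n : ℕ ↦ χ n * ((Λ n : ℂ) * ((((x / n : ℝ)) : ℂ) ^ s / s)))
      ((-logDeriv χ.LFunction s) * ((x : ℂ) ^ s / s)) := by
  set f : ℕ → ℂ := (fun n : ℕ ↦ χ n) * fun n : ℕ ↦ (Λ n : ℂ) with hf
  have h1 : HasSum (LSeries.term f s) (LSeries f s) :=
    (DirichletCharacter.LSeriesSummable_twist_vonMangoldt χ hs).hasSum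
  have hval : LSeries f s = -logDeriv χ.LFunction s := by
    rw [logDeriv_apply, DirichletCharacter.deriv_LFunction_eq_deriv_LSeries χ hs,
      DirichletCharacter.LFunction_eq_LSeries χ hs, hf,
      DirichletCharacter.LSeries_twist_vonMangoldt_eq χ hs]
    ring
  rw [hval] at h1
  have h2 := h1.mul_right ((x : ℂ) ^ s / s)
  have hfun : (fun n : ℕ ↦ χ n * ((Λ n : ℂ) * ((((x / n : ℝ)) : ℂ) ^ s / s))) =
      fun n ↦ LSeries.term f s n * ((x : ℂ) ^ s / s) := by
    funext n
    rcases Nat.eq_zero_or_pos n with rfl | hn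
    · simp
    · rw [LSeries.term_of_ne_zero hn.ne', ofReal_div_cpow hx.le (by exact_mod_cast hn) s, hf,
        Pi.mul_apply]
      push_cast
      ring
  rw [hfun]
  exact h2

/-! ### `ψ₀(x, χ)` and the Perron weights -/

omit [NeZero q] in
/-- `∑_n χ(n)Λ(n) w(n) = 2ψ₀(x, χ)` for the Perron weight `w(n) = [n < x] + [n ≤ x]` (`2` if `n < x`,
`1` if `n = x`, `0` if `n > x`). [cite: MontgomeryVaughan2007, Thm. 5.1, §12.1] -/
theorem sum_twist_mul_weight (χ : DirichletCharacter ℂ q) {x : ℝ} (hx : 0 < x) :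
    ∑ n ∈ Finset.range (⌊x⌋₊ + 1),
      χ n * Λ n * (((if (n : ℝ) < x then 1 else 0) + (if (n : ℝ) ≤ x then 1 else 0) : ℝ) : ℂ) =
        2 * chebyshevPsiChar₀ χ x := by
  classical
  have hle : ∀ n ∈ Finset.range (⌊x⌋₊ + 1), (n : ℝ) ≤ x := by
    intro n hn
    rw [Finset.mem_range] at hn
    exact le_trans (by exact_mod_cast Nat.lt_succ_iff.1 hn) (Nat.floor_le hx.le)
  -- the weight `[n ≤ x]` is `1` throughout, the weight `[n < x]` is `1` except at `n = x`
  have hw : ∀ n ∈ Finset.range (⌊x⌋₊ + 1),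
      χ n * Λ n * (((if (n : ℝ) < x then 1 else 0) + (if (n : ℝ) ≤ x then 1 else 0) : ℝ) : ℂ) =
        2 * (χ n * Λ n) - (if (n : ℝ) = x then χ n * Λ n else 0) := by
    intro n hn
    have h1 : (n : ℝ) ≤ x := hle n hn
    by_cases h2 : (n : ℝ) = x
    · simp [h2]
      ring
    · have : (n : ℝ) < x := lt_of_le_of_ne h1 h2
      simp [this, h1, h2]
      ring
  rw [Finset.sum_congr rfl hw, Finset.sum_sub_distrib, ← Finset.mul_sum, ← Finset.sum_filter]
  -- the filtered sum is the correction term of `ψ₀`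
  have hcorr : ∑ n ∈ (Finset.range (⌊x⌋₊ + 1)).filter (fun n : ℕ ↦ (n : ℝ) = x), χ n * (Λ n : ℂ) =
      if ((⌊x⌋₊ : ℕ) : ℝ) = x then χ (⌊x⌋₊ : ℕ) * Λ ⌊x⌋₊ else 0 := by
    split_ifs with h
    · have hfilt : (Finset.range (⌊x⌋₊ + 1)).filter (fun n : ℕ ↦ (n : ℝ) = x) = {⌊x⌋₊} := by
        ext n
        simp only [Finset.mem_filter, Finset.mem_range, Finset.mem_singleton]
        constructor
        · rintro ⟨-, hn⟩
          exact_mod_cast (hn.trans h.symm)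
        · rintro rfl
          exact ⟨Nat.lt_succ_self _, h⟩
      rw [hfilt, Finset.sum_singleton]
    · have hfilt : (Finset.range (⌊x⌋₊ + 1)).filter (fun n : ℕ ↦ (n : ℝ) = x) = ∅ := by
        ext n
        simp only [Finset.mem_filter, Finset.mem_range, Finset.notMem_empty, iff_false, not_and]
        intro hn hnx
        have : n = ⌊x⌋₊ := by
          rw [← hnx, Nat.floor_natCast]
        rw [this] at hnx
        exact h hnx
      rw [hfilt, Finset.sum_empty]
  rw [hcorr, chebyshevPsiChar₀, chebyshevPsiChar]
  split_ifs <;> ring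

/-! ### The truncated Perron formula for `ψ₀(x, χ)` -/

/-- Continuity of the Perron integrand `(−L'/L)(b+it, χ) x^{b+it}/(b+it)` in `t` (`b > 1`). [folklore] -/
theorem continuous_perronIntegrand (χ : DirichletCharacter ℂ q) {x b : ℝ} (hx : 0 < x)
    (hb : 1 < b) :
    Continuous fun t : ℝ ↦ (-logDeriv χ.LFunction (b + t * I)) *
      ((x : ℂ) ^ ((b : ℂ) + t * I) / ((b : ℂ) + t * I)) := by
  refine continuous_iff_continuousAt.2 fun t ↦ ?_
  set s : ℂ := (b : ℂ) + t * I with hs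
  have hsre : s.re = b := by simp [hs]
  have hs1 : s ≠ 1 := fun h ↦ by have := congrArg Complex.re h; rw [hsre] at this; simp at this; linarith
  have hs0 : s ≠ 0 := fun h ↦ by have := congrArg Complex.re h; rw [hsre] at this; simp at this; linarith
  have hL : χ.LFunction s ≠ 0 :=
    DirichletCharacter.LFunction_ne_zero_of_one_le_re χ (Or.inr hs1) (by rw [hsre]; exact hb.le)
  have hdL : DifferentiableAt ℂ χ.LFunction s := DirichletCharacter.differentiableAt_LFunction χ s (Or.inl hs1)
  have h1 : ContinuousAt (fun s : ℂ ↦ (-logDeriv χ.LFunction s) * ((x : ℂ) ^ s / s)) s := by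
    have hd : DifferentiableAt ℂ (deriv χ.LFunction) s := by
      have hopen : IsOpen ({1}ᶜ : Set ℂ) := isOpen_compl_singleton
      have han : AnalyticAt ℂ χ.LFunction s := by
        refine DifferentiableOn.analyticAt (s := {1}ᶜ) (fun z hz ↦ ?_) (hopen.mem_nhds hs1)
        exact (DirichletCharacter.differentiableAt_LFunction χ z (Or.inl hz)).differentiableWithinAt
      exact han.deriv.differentiableAt
    have hld : DifferentiableAt ℂ (fun s ↦ logDeriv χ.LFunction s) s := by
      simp_rw [logDeriv_apply]
      exact hd.div hdL hL
    exact (hld.neg.mul (differentiableAt_cpow_div hx hs0)).continuousAt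
  exact h1.comp (f := fun t : ℝ ↦ (b : ℂ) + t * I) (Continuous.continuousAt (by fun_prop))

set_option maxHeartbeats 1600000 in
/-- **The truncated Perron formula for `ψ₀(x, χ)`** (Montgomery–Vaughan Thm. 5.2 with Cor. 5.3, for
`a_n = χ(n)Λ(n)`, `σ₀ = 1 + 1/log x`, as in the proofs of Thm. 12.5 and Thm. 12.10): for every
`c > 1` there is `C` (depending on `c` only) such that for every Dirichlet character `χ` to any
modulus, every `x ≥ c`, `T ≥ 1` and `b = 1 + 1/log x`,
`‖∫_{-T}^{T} (−L'/L)(b+it, χ) x^{b+it}/(b+it) dt − 2π ψ₀(x, χ)‖ ≤ C((log x) min(1, x/(T⟨x⟩)) + (x/T) log² x)`,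
i.e. `ψ₀(x, χ) = (1/2πi)∫_{b−iT}^{b+iT} (−L'/L)(s, χ) x^s ds/s + R₁`,
`R₁ ≪ (log x) min(1, x/(T⟨x⟩)) + (x/T)(log x)²`. [cite: MontgomeryVaughan2007, Thm. 12.10 (proof)] -/
theorem perron_chebyshevPsiChar₀ {c : ℝ} (hc : 1 < c) :
    ∃ C : ℝ, 0 < C ∧ ∀ (q : ℕ) [NeZero q] (χ : DirichletCharacter ℂ q),
      ∀ x : ℝ, c ≤ x → ∀ T : ℝ, 1 ≤ T → ∀ b : ℝ, b = 1 + 1 / Real.log x →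
      ‖(∫ t in (-T)..T, (-logDeriv χ.LFunction (b + t * I)) *
            ((x : ℂ) ^ ((b : ℂ) + t * I) / ((b : ℂ) + t * I))) - 2 * π * chebyshevPsiChar₀ χ x‖ ≤
        C * (Real.log x * min 1 (x / (T * primePowDist x)) + x / T * Real.log x ^ 2) := by
  obtain ⟨K₀, hK₀0, hK₀⟩ := exists_tsum_vonMangoldt_div_rpow_le'
  set lam : ℝ := Real.log c with hlam
  have hlam0 : 0 < lam := Real.log_pos hc
  set μ : ℝ := max 1 (1 / lam) with hμ
  have hμ1 : 1 ≤ μ := le_max_left _ _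
  have hμ2 : 1 / lam ≤ μ := le_max_right _ _
  set β : ℝ := (2 : ℝ) ^ (1 + 1 / lam) with hβ
  have hβ0 : 0 ≤ β := by positivity
  set γ : ℝ := 2 * β + 4 * μ + 4 with hγ
  set A₁ : ℝ := 2 * Real.exp 1 / Real.log 2 * μ ^ 2 * (1 + K₀) with hA₁
  have hlog2 : 0 < Real.log 2 := Real.log_pos one_lt_two
  set C : ℝ := A₁ + 4 * μ ^ 2 + 8 * γ * μ + 48 * γ * μ ^ 2 with hC
  refine ⟨C, by positivity, fun q _ χ x hx T hT b hb ↦ ?_⟩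
  classical
  -- basic facts
  have hx1 : 1 < x := hc.trans_le hx
  have hx0 : 0 < x := by linarith
  set L : ℝ := Real.log x with hL
  have hLlam : lam ≤ L := Real.log_le_log (by linarith) hx
  have hL0 : 0 < L := hlam0.trans_le hLlam
  have hb1 : 1 < b := by rw [hb]; simp [hL0]
  have hb0 : 0 < b := by linarith
  have hbm1 : 1 / (b - 1) = L := by rw [hb, add_sub_cancel_left, one_div_one_div]
  have hbμ : b ≤ 2 * μ := by
    rw [hb]
    have : 1 / L ≤ 1 / lam := one_div_le_one_div_of_le hlam0 hLlam
    linarith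
  have hxb : x ^ b = Real.exp 1 * x := by
    rw [hb, Real.rpow_add hx0, Real.rpow_one, Real.rpow_def_of_pos hx0, ← hL,
      mul_one_div_cancel hL0.ne', mul_comm]
  have hT0 : 0 < T := by linarith
  have hμL : 1 ≤ μ * L := by
    calc (1 : ℝ) = 1 / lam * lam := by field_simp
      _ ≤ μ * L := mul_le_mul hμ2 hLlam hlam0.le (by positivity)
  have h2b : (2 : ℝ) ^ b ≤ β := by
    rw [hβ]
    refine Real.rpow_le_rpow_of_exponent_le one_le_two ?_
    rw [hb]
    have : 1 / L ≤ 1 / lam := one_div_le_one_div_of_le hlam0 hLlam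
    linarith
  -- the pieces of the error budget
  set M : ℝ := min 1 (x / (T * primePowDist x)) with hM
  have hM0 : 0 ≤ M := le_min zero_le_one (by have := primePowDist_pos x; positivity)
  have hM1 : M ≤ 1 := min_le_left _ _
  set P : ℝ := x / T * L ^ 2 with hP
  have hP0 : 0 ≤ P := by positivity
  have hxT : 0 ≤ x / T := by positivity
  -- the termwise data
  set F : ℕ → ℝ → ℂ := fun n t ↦
    χ n * ((Λ n : ℂ) * ((((x / n : ℝ)) : ℂ) ^ ((b : ℂ) + t * I) / ((b : ℂ) + t * I))) with hF
  set f : ℝ → ℂ := fun t ↦ (-logDeriv χ.LFunction (b + t * I)) *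
    ((x : ℂ) ^ ((b : ℂ) + t * I) / ((b : ℂ) + t * I)) with hf
  -- summability of the dominating series
  obtain ⟨hsumb, htsumb⟩ := hK₀ b hb1
  have hbsum : Summable fun n : ℕ ↦ Λ n * (x / n) ^ b / b := by
    have := hsumb.mul_left (x ^ b / b)
    refine this.congr fun n ↦ ?_
    rw [Real.div_rpow hx0.le (Nat.cast_nonneg n)]
    field_simp
  have hχle : ∀ n : ℕ, ‖χ n‖ ≤ 1 := fun n ↦ χ.norm_le_one _
  -- (1) termwise integration
  have hDCT : HasSum (fun n ↦ ∫ t in (-T)..T, F n t) (∫ t in (-T)..T, f t) := by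
    refine intervalIntegral.hasSum_integral_of_dominated_convergence
      (fun n _ ↦ Λ n * (x / n) ^ b / b)
      (fun n ↦ (continuous_const.mul (continuous_perronTerm hx0 hb0 n)).aestronglyMeasurable)
      (fun n ↦ Eventually.of_forall fun t _ ↦ ?_)
      (Eventually.of_forall fun t _ ↦ hbsum) intervalIntegrable_const
      (Eventually.of_forall fun t _ ↦ ?_)
    · calc ‖F n t‖ = ‖χ n‖ * ‖(Λ n : ℂ) * ((((x / n : ℝ)) : ℂ) ^ ((b : ℂ) + t * I) / ((b : ℂ) + t * I))‖ :=
            norm_mul _ _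
        _ ≤ 1 * (Λ n * (x / n) ^ b / b) :=
            mul_le_mul (hχle n) (norm_perronTerm_le hx0 hb0 n t) (norm_nonneg _) zero_le_one
        _ = Λ n * (x / n) ^ b / b := one_mul _
    · have hs : 1 < ((b : ℂ) + t * I).re := by simp; linarith
      exact hasSum_twist_vonMangoldt_mul_cpow_div χ hx0 hs
  have hFint : ∀ n, ∫ t in (-T)..T, F n t = (χ n * Λ n : ℂ) *
      ∫ t in (-T)..T, ((((x / n : ℝ)) : ℂ) ^ ((b : ℂ) + t * I) / ((b : ℂ) + t * I)) := by
    intro n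
    rw [← intervalIntegral.integral_const_mul]
    refine intervalIntegral.integral_congr fun t _ ↦ ?_
    simp only [hF]; ring
  -- (2) the main term
  set ind : ℕ → ℂ := fun n ↦ (χ n * Λ n : ℂ) *
    ((π * ((if (n : ℝ) < x then 1 else 0) + (if (n : ℝ) ≤ x then 1 else 0)) : ℝ) : ℂ) with hind
  have hind0 : ∀ n ∉ Finset.range (⌊x⌋₊ + 1), ind n = 0 := by
    intro n hn
    rw [Finset.mem_range, not_lt] at hn
    have hxn : x < n := lt_of_lt_of_le (Nat.lt_floor_add_one x) (by exact_mod_cast hn)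
    simp [hind, not_lt.2 hxn.le, not_le.2 hxn]
  have hindsum : HasSum ind (2 * π * chebyshevPsiChar₀ χ x) := by
    have h : HasSum ind (∑ n ∈ Finset.range (⌊x⌋₊ + 1), ind n) := hasSum_sum_of_ne_finset_zero hind0
    have hval : ∑ n ∈ Finset.range (⌊x⌋₊ + 1), ind n = 2 * π * chebyshevPsiChar₀ χ x := by
      have : ∑ n ∈ Finset.range (⌊x⌋₊ + 1), ind n =
          (π : ℂ) * ∑ n ∈ Finset.range (⌊x⌋₊ + 1), χ n * Λ n *
            (((if (n : ℝ) < x then 1 else 0) + (if (n : ℝ) ≤ x then 1 else 0) : ℝ) : ℂ) := by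
        rw [Finset.mul_sum]
        refine Finset.sum_congr rfl fun n _ ↦ ?_
        simp only [hind]; push_cast; ring
      rw [this, sum_twist_mul_weight χ hx0]
      ring
    rwa [hval] at h
  -- (3) the majorant
  set Cb : ℝ := 2 * (2 : ℝ) ^ b + 2 * b / T + π with hCb
  have hCb0 : 0 ≤ Cb := by positivity
  have hCbγ : Cb ≤ γ := by
    rw [hCb, hγ]
    have h1 : 2 * b / T ≤ 2 * b := by
      rw [div_le_iff₀ hT0]; nlinarith
    have h2 : π ≤ 4 := Real.pi_le_four
    nlinarith
  set e₁ : ℕ → ℝ := fun n ↦ (x / n) ^ b * (2 / T) / Real.log 2 with he₁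
  set e₂ : ℕ → ℝ := fun n ↦ if (n : ℝ) = x then 2 * b / T else 0 with he₂
  set e₃ : ℕ → ℝ := fun n ↦ if x / 2 < n ∧ (n : ℝ) < 2 * x ∧ (n : ℝ) ≠ x then
    Cb * (2 * min 1 (x / (T * |x - n|))) else 0 with he₃
  have he₁0 : ∀ n, 0 ≤ e₁ n := fun n ↦ by positivity
  have he₂0 : ∀ n, 0 ≤ e₂ n := fun n ↦ by simp only [he₂]; split_ifs <;> positivity
  have he₃0 : ∀ n, 0 ≤ e₃ n := fun n ↦ by
    simp only [he₃]; split_ifs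
    · exact mul_nonneg hCb0 (mul_nonneg zero_le_two (le_min zero_le_one (by positivity)))
    · exact le_rfl
  set g : ℕ → ℝ := fun n ↦ Λ n * (e₁ n + e₂ n + e₃ n) with hg
  have hg0 : ∀ n, 0 ≤ g n := fun n ↦ mul_nonneg vonMangoldt_nonneg (by linarith [he₁0 n, he₂0 n, he₃0 n])
  -- (4) the termwise error bound: first the kernel
  have hker : ∀ n : ℕ, 0 < n →
      ‖(∫ t in (-T)..T, ((((x / n : ℝ)) : ℂ) ^ ((b : ℂ) + t * I) / ((b : ℂ) + t * I))) -
        ((π * ((if (n : ℝ) < x then 1 else 0) + (if (n : ℝ) ≤ x then 1 else 0)) : ℝ) : ℂ)‖ ≤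
        e₁ n + e₂ n + e₃ n := by
    intro n hn0
    have hn' : (0 : ℝ) < n := by exact_mod_cast hn0
    have hy0 : 0 < x / n := div_pos hx0 hn'
    by_cases hnx : (n : ℝ) = x
    · -- `n = x`: the kernel at `y = 1`
      have hy1 : x / (n : ℝ) = 1 := by rw [hnx, div_self hx0.ne']
      have hw : π * ((if (n : ℝ) < x then 1 else 0) + (if (n : ℝ) ≤ x then 1 else 0)) = π := by
        simp [hnx]
      rw [hw, hy1]
      have h := norm_perronIntegral_one_sub_pi_le hb0 hT0
      push_cast at h ⊢
      refine h.trans ?_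
      have : e₂ n = 2 * b / T := by simp [he₂, hnx]
      linarith [he₁0 n, he₃0 n]
    · have hy1 : x / (n : ℝ) ≠ 1 := fun h ↦ hnx (by rw [div_eq_one_iff_eq hn'.ne'] at h; exact h.symm)
      have hw : π * ((if (n : ℝ) < x then 1 else 0) + (if (n : ℝ) ≤ x then 1 else 0)) =
          if 1 < x / (n : ℝ) then 2 * π else 0 := by
        rcases lt_or_gt_of_ne hnx with h | h
        · have h1 : 1 < x / (n : ℝ) := by rw [one_lt_div hn']; exact h
          simp [h, h.le, h1]; ring
        · have h1 : ¬ 1 < x / (n : ℝ) := by rw [one_lt_div hn', not_lt]; exact h.le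
          simp [not_lt.2 h.le, not_le.2 h, h1]
      rw [hw]
      by_cases hnear : x / 2 < n ∧ (n : ℝ) < 2 * x
      · -- `x/2 < n < 2x`: the kernel with the `min`
        have h := norm_perronIntegral_sub_indicator_le_min hy0 hy1 hb0 hT0
        refine h.trans ?_
        have hyb : (x / n) ^ b ≤ (2 : ℝ) ^ b := by
          refine Real.rpow_le_rpow hy0.le ?_ hb0.le
          rw [div_le_iff₀ hn']; linarith [hnear.1]
        have hmax : max 1 ((x / n) ^ b) ≤ (2 : ℝ) ^ b :=
          max_le (Real.one_le_rpow one_le_two hb0.le) hyb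
        have hmin := min_le_two_mul_min hx0 hnear.1 hnear.2 hnx hT0
        have he3 : e₃ n = Cb * (2 * min 1 (x / (T * |x - n|))) := by simp [he₃, hnear.1, hnear.2, hnx]
        calc (2 * max 1 ((x / n) ^ b) + 2 * b / T + π) * min 1 (1 / (T * |Real.log (x / n)|))
            ≤ Cb * (2 * min 1 (x / (T * |x - n|))) := by
              refine mul_le_mul (by rw [hCb]; linarith) hmin (le_min zero_le_one (by positivity)) hCb0
          _ = e₃ n := he3.symm
          _ ≤ e₁ n + e₂ n + e₃ n := by linarith [he₁0 n, he₂0 n]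
      · -- `n ≤ x/2` or `n ≥ 2x`: `|log y| ≥ log 2`
        have h := norm_perronIntegral_sub_le hy0 hy1 hb0 hT0 hT0
        refine h.trans ?_
        have hlogy : Real.log 2 ≤ |Real.log (x / n)| := by
          rw [not_and_or, not_lt, not_lt] at hnear
          rcases hnear with h2 | h2
          · have hy2 : 2 ≤ x / n := by rw [le_div_iff₀ hn']; linarith
            rw [abs_of_pos (Real.log_pos (by linarith))]
            exact Real.log_le_log two_pos hy2
          · have hy2 : x / n ≤ 1 / 2 := by rw [div_le_iff₀ hn']; linarith
            have hlt : Real.log (x / n) < 0 := Real.log_neg hy0 (by linarith)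
            rw [abs_of_neg hlt]
            have := Real.log_le_log hy0 hy2
            rw [one_div, Real.log_inv] at this
            linarith
        calc (x / n) ^ b * (1 / T + 1 / T) / |Real.log (x / n)|
            ≤ (x / n) ^ b * (1 / T + 1 / T) / Real.log 2 :=
              div_le_div_of_nonneg_left (by positivity) hlog2 hlogy
          _ = e₁ n := by simp only [he₁]; ring
          _ ≤ e₁ n + e₂ n + e₃ n := by linarith [he₂0 n, he₃0 n]
  have herr : ∀ n, ‖(∫ t in (-T)..T, F n t) - ind n‖ ≤ g n := by
    intro n
    rcases Nat.eq_zero_or_pos n with rfl | hn0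
    · simp [hFint, hind, hg]
    have hΛ : 0 ≤ Λ n := vonMangoldt_nonneg
    rw [hFint, hind, ← mul_sub, norm_mul, hg]
    have hcoef : ‖(χ n * Λ n : ℂ)‖ ≤ Λ n := by
      rw [norm_mul, Complex.norm_real, Real.norm_eq_abs, abs_of_nonneg hΛ]
      exact mul_le_of_le_one_left hΛ (hχle n)
    exact mul_le_mul hcoef (hker n hn0) (norm_nonneg _) hΛ
  -- (5) partial sums of the majorant
  have hΛle : ∀ n : ℕ, (n : ℝ) < 2 * x → Λ n ≤ Real.log (2 * x) := by
    intro n hn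
    rcases Nat.eq_zero_or_pos n with rfl | hn0
    · simp only [ArithmeticFunction.map_zero]; exact Real.log_nonneg (by linarith)
    · exact vonMangoldt_le_log.trans (Real.log_le_log (by exact_mod_cast hn0) hn.le)
  have hLμL : L ≤ μ * L := le_mul_of_one_le_left hL0.le hμ1
  have hlog2x : Real.log (2 * x) ≤ 2 * μ * L := by
    rw [Real.log_mul two_ne_zero hx0.ne', ← hL]
    have : Real.log 2 < 1 := by have := Real.log_two_lt_d9; linarith
    linarith
  have hlog2x0 : 0 ≤ Real.log (2 * x) := Real.log_nonneg (by linarith)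
  have hlog2x1 : 1 + Real.log (2 * x + 1) ≤ 4 * μ * L := by
    have h3 : Real.log (2 * x + 1) ≤ Real.log 3 + L := by
      rw [hL, ← Real.log_mul (by norm_num) hx0.ne']
      exact Real.log_le_log (by linarith) (by linarith)
    have h3' : Real.log 3 < 2 := by
      have h9 : (3 : ℝ) < Real.exp 2 := by
        have h := Real.exp_one_gt_d9
        have : Real.exp 2 = Real.exp 1 * Real.exp 1 := by rw [← Real.exp_add]; norm_num
        nlinarith
      have : Real.log 3 < Real.log (Real.exp 2) := Real.log_lt_log (by norm_num) h9
      rwa [Real.log_exp] at this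
    linarith
  -- (5a) `e₁`
  have hS1 : ∀ s : Finset ℕ, ∑ n ∈ s, Λ n * e₁ n ≤ A₁ * P := by
    intro s
    have h1 : ∑ n ∈ s, Λ n * e₁ n = (2 / (T * Real.log 2) * x ^ b) * ∑ n ∈ s, Λ n / (n : ℝ) ^ b := by
      rw [Finset.mul_sum]
      refine Finset.sum_congr rfl fun n _ ↦ ?_
      simp only [he₁]
      rw [Real.div_rpow hx0.le (Nat.cast_nonneg n)]
      field_simp
    rw [h1]
    have h2 : ∑ n ∈ s, Λ n / (n : ℝ) ^ b ≤ μ * L + K₀ := by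
      refine (hsumb.sum_le_tsum s fun n _ ↦ div_nonneg vonMangoldt_nonneg
        (Real.rpow_nonneg (Nat.cast_nonneg n) _)).trans (htsumb.trans ?_)
      rw [hbm1]
      have : max L 1 ≤ μ * L := max_le (by nlinarith) hμL
      linarith
    calc 2 / (T * Real.log 2) * x ^ b * ∑ n ∈ s, Λ n / (n : ℝ) ^ b
        ≤ 2 / (T * Real.log 2) * x ^ b * (μ * L + K₀) :=
          mul_le_mul_of_nonneg_left h2 (by positivity)
      _ = 2 * Real.exp 1 / Real.log 2 * (x / T) * (μ * L + K₀) := by rw [hxb]; field_simp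
      _ ≤ 2 * Real.exp 1 / Real.log 2 * (x / T) * (μ * L * (μ * L) + K₀ * (μ * L) * (μ * L)) := by
          refine mul_le_mul_of_nonneg_left ?_ (by positivity)
          have hKL : K₀ ≤ K₀ * (μ * L) * (μ * L) := by
            have : K₀ * 1 ≤ K₀ * (μ * L) := mul_le_mul_of_nonneg_left hμL hK₀0
            nlinarith
          nlinarith
      _ = A₁ * P := by rw [hA₁, hP]; ring
  -- (5b) `e₂`
  have hS2 : ∀ s : Finset ℕ, ∑ n ∈ s, Λ n * e₂ n ≤ 4 * μ ^ 2 * P := by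
    intro s
    have h1 : ∑ n ∈ s, Λ n * e₂ n = ∑ n ∈ s.filter (fun n : ℕ ↦ (n : ℝ) = x), Λ n * (2 * b / T) := by
      rw [Finset.sum_filter]
      refine Finset.sum_congr rfl fun n _ ↦ ?_
      simp only [he₂]; split_ifs <;> simp
    have hcard : (s.filter (fun n : ℕ ↦ (n : ℝ) = x)).card ≤ 1 := by
      refine Finset.card_le_one.2 fun a ha b' hb' ↦ ?_
      rw [Finset.mem_filter] at ha hb'
      exact_mod_cast (ha.2.trans hb'.2.symm)
    have h2 : ∑ n ∈ s.filter (fun n : ℕ ↦ (n : ℝ) = x), Λ n * (2 * b / T) ≤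
        (s.filter (fun n : ℕ ↦ (n : ℝ) = x)).card • (L * (2 * b / T)) := by
      refine Finset.sum_le_card_nsmul _ _ _ fun n hn ↦ ?_
      rw [Finset.mem_filter] at hn
      refine mul_le_mul_of_nonneg_right ?_ (by positivity)
      have hn0 : n ≠ 0 := by rintro rfl; simp at hn; linarith
      calc Λ n ≤ Real.log n := vonMangoldt_le_log
        _ = L := by rw [hn.2]
    rw [h1]
    refine h2.trans ?_
    calc (s.filter (fun n : ℕ ↦ (n : ℝ) = x)).card • (L * (2 * b / T)) ≤ 1 • (L * (2 * b / T)) := by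
          exact nsmul_le_nsmul_left (by positivity) hcard
      _ = 2 * b * (L / T) := by rw [one_nsmul]; ring
      _ ≤ 2 * (2 * μ) * (x / T * L * (μ * L)) := by
          have hLT : L / T ≤ x / T * L := by
            rw [div_mul_eq_mul_div, div_le_div_iff_of_pos_right hT0]; nlinarith
          have hLT' : x / T * L ≤ x / T * L * (μ * L) := by
            have : x / T * L * 1 ≤ x / T * L * (μ * L) := mul_le_mul_of_nonneg_left hμL (by positivity)
            linarith
          have : 0 ≤ L / T := by positivity
          nlinarith
      _ = 4 * μ ^ 2 * P := by rw [hP]; ring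
  -- (5c) `e₃`
  have hS3 : ∀ s : Finset ℕ, ∑ n ∈ s, Λ n * e₃ n ≤ 8 * γ * μ * (L * M) + 48 * γ * μ ^ 2 * P := by
    intro s
    set cond : ℕ → Prop := fun n ↦ x / 2 < n ∧ (n : ℝ) < 2 * x ∧ (n : ℝ) ≠ x with hcond
    have h1 : ∑ n ∈ s, Λ n * e₃ n =
        2 * Cb * ∑ n ∈ s.filter cond, Λ n * min 1 (x / (T * |x - n|)) := by
      rw [Finset.mul_sum, Finset.sum_filter]
      refine Finset.sum_congr rfl fun n _ ↦ ?_
      simp only [he₃]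
      split_ifs <;> ring
    rw [h1]
    set S := s.filter cond with hS
    have hnear : ∑ n ∈ S.filter (fun n : ℕ ↦ |x - n| < 1), Λ n * min 1 (x / (T * |x - n|)) ≤
        2 * (Real.log (2 * x) * M) := by
      have hterm : ∀ n ∈ S.filter (fun n : ℕ ↦ |x - n| < 1),
          Λ n * min 1 (x / (T * |x - n|)) ≤ Real.log (2 * x) * M := by
        intro n hn
        rw [Finset.mem_filter, hS, Finset.mem_filter] at hn
        obtain ⟨⟨-, h1, h2, h3⟩, -⟩ := hn
        by_cases hΛ0 : Λ n = 0
        · rw [hΛ0, zero_mul]; positivity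
        · have hpp : IsPrimePow n := vonMangoldt_ne_zero_iff.1 hΛ0
          have hd := primePowDist_le hpp h3
          have hd0 := primePowDist_pos x
          refine mul_le_mul (hΛle n h2) ?_ (le_min zero_le_one (by positivity)) hlog2x0
          exact min_le_min_left _ (by gcongr)
      calc ∑ n ∈ S.filter (fun n : ℕ ↦ |x - n| < 1), Λ n * min 1 (x / (T * |x - n|))
          ≤ (S.filter (fun n : ℕ ↦ |x - n| < 1)).card • (Real.log (2 * x) * M) :=
            Finset.sum_le_card_nsmul _ _ _ hterm
        _ ≤ 2 • (Real.log (2 * x) * M) :=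
            nsmul_le_nsmul_left (by positivity) (card_filter_abs_sub_lt_one_le hx0.le S)
        _ = 2 * (Real.log (2 * x) * M) := by rw [two_nsmul]; ring
    have hfar : ∑ n ∈ S.filter (fun n : ℕ ↦ ¬ |x - n| < 1), Λ n * min 1 (x / (T * |x - n|)) ≤
        Real.log (2 * x) * (x / T) * (3 * (1 + Real.log (2 * x + 1))) := by
      set S' := S.filter (fun n : ℕ ↦ ¬ |x - n| < 1) with hS'
      have hmemS' : ∀ n ∈ S', cond n ∧ 1 ≤ |x - n| := by
        intro n hn
        rw [hS', Finset.mem_filter, hS, Finset.mem_filter, not_lt] at hn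
        exact ⟨hn.1.2, hn.2⟩
      have hterm : ∀ n ∈ S', Λ n * min 1 (x / (T * |x - n|)) ≤
          Real.log (2 * x) * (x / T) * (1 / |x - n|) := by
        intro n hn
        obtain ⟨⟨h1, h2, h3⟩, h4⟩ := hmemS' n hn
        have : min 1 (x / (T * |x - n|)) ≤ x / T * (1 / |x - n|) := by
          refine (min_le_right _ _).trans (le_of_eq ?_)
          field_simp
        calc Λ n * min 1 (x / (T * |x - n|)) ≤ Real.log (2 * x) * (x / T * (1 / |x - n|)) :=
              mul_le_mul (hΛle n h2) this (le_min zero_le_one (by positivity)) hlog2x0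
          _ = Real.log (2 * x) * (x / T) * (1 / |x - n|) := by ring
      have hsum : ∑ n ∈ S', 1 / |x - (n : ℝ)| ≤ 3 * (1 + Real.log (2 * x + 1)) := by
        rw [← Finset.sum_filter_add_sum_filter_not S' (fun n : ℕ ↦ (n : ℝ) < x)]
        have hleft : ∑ n ∈ S'.filter (fun n : ℕ ↦ (n : ℝ) < x), 1 / |x - (n : ℝ)| ≤ 1 + Real.log x := by
          have hall : ∀ n ∈ S'.filter (fun n : ℕ ↦ (n : ℝ) < x), (n : ℝ) < x ∧ 1 ≤ x - n := by
            intro n hn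
            rw [Finset.mem_filter] at hn
            have h := (hmemS' n hn.1).2
            rw [abs_of_pos (by linarith [hn.2])] at h
            exact ⟨hn.2, h⟩
          calc ∑ n ∈ S'.filter (fun n : ℕ ↦ (n : ℝ) < x), 1 / |x - (n : ℝ)|
              = ∑ n ∈ S'.filter (fun n : ℕ ↦ (n : ℝ) < x), 1 / (x - n) :=
                Finset.sum_congr rfl fun n hn ↦ by rw [abs_of_pos (by linarith [(hall n hn).2])]
            _ = ∑ n ∈ (S'.filter (fun n : ℕ ↦ (n : ℝ) < x)).filter
                  (fun n : ℕ ↦ (n : ℝ) < x ∧ 1 ≤ x - n), 1 / (x - n) := by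
                rw [Finset.filter_true_of_mem hall]
            _ ≤ 1 + Real.log x := sum_inv_sub_left_le hx1.le _
        have hright : ∑ n ∈ S'.filter (fun n : ℕ ↦ ¬ (n : ℝ) < x), 1 / |x - (n : ℝ)| ≤
            2 * (1 + Real.log (2 * x + 1)) := by
          have hall : ∀ n ∈ S'.filter (fun n : ℕ ↦ ¬ (n : ℝ) < x),
              x < n ∧ 1 ≤ (n : ℝ) - x ∧ (n : ℝ) < 2 * x := by
            intro n hn
            rw [Finset.mem_filter, not_lt] at hn
            obtain ⟨⟨h1, h2, h3⟩, h4⟩ := hmemS' n hn.1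
            have hxn : x < n := lt_of_le_of_ne hn.2 (Ne.symm h3)
            rw [abs_of_neg (by linarith)] at h4
            exact ⟨hxn, by linarith, h2⟩
          calc ∑ n ∈ S'.filter (fun n : ℕ ↦ ¬ (n : ℝ) < x), 1 / |x - (n : ℝ)|
              = ∑ n ∈ S'.filter (fun n : ℕ ↦ ¬ (n : ℝ) < x), 1 / ((n : ℝ) - x) :=
                Finset.sum_congr rfl fun n hn ↦ by
                  rw [abs_of_neg (by linarith [(hall n hn).1]), neg_sub]
            _ = ∑ n ∈ (S'.filter (fun n : ℕ ↦ ¬ (n : ℝ) < x)).filter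
                  (fun n : ℕ ↦ x < n ∧ 1 ≤ (n : ℝ) - x ∧ (n : ℝ) < 2 * x), 1 / ((n : ℝ) - x) := by
                rw [Finset.filter_true_of_mem hall]
            _ ≤ 2 * (1 + Real.log (2 * x + 1)) := sum_inv_sub_right_le hx0.le _
        have hlx : Real.log x ≤ Real.log (2 * x + 1) := Real.log_le_log hx0 (by linarith)
        linarith
      calc ∑ n ∈ S', Λ n * min 1 (x / (T * |x - n|))
          ≤ ∑ n ∈ S', Real.log (2 * x) * (x / T) * (1 / |x - n|) := Finset.sum_le_sum hterm
        _ = Real.log (2 * x) * (x / T) * ∑ n ∈ S', 1 / |x - (n : ℝ)| := by rw [Finset.mul_sum]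
        _ ≤ Real.log (2 * x) * (x / T) * (3 * (1 + Real.log (2 * x + 1))) :=
            mul_le_mul_of_nonneg_left hsum (by positivity)
    rw [← Finset.sum_filter_add_sum_filter_not S (fun n : ℕ ↦ |x - n| < 1)]
    have hsum2 := add_le_add hnear hfar
    calc 2 * Cb * (∑ n ∈ S.filter (fun n : ℕ ↦ |x - n| < 1), Λ n * min 1 (x / (T * |x - n|)) +
          ∑ n ∈ S.filter (fun n : ℕ ↦ ¬ |x - n| < 1), Λ n * min 1 (x / (T * |x - n|)))
        ≤ 2 * γ * (2 * (Real.log (2 * x) * M) +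
            Real.log (2 * x) * (x / T) * (3 * (1 + Real.log (2 * x + 1)))) := by
          refine mul_le_mul (by linarith) hsum2 ?_ (by positivity)
          positivity
      _ ≤ 2 * γ * (2 * (2 * μ * L * M) + 2 * μ * L * (x / T) * (3 * (4 * μ * L))) := by
          have hγ0 : 0 ≤ γ := by positivity
          refine mul_le_mul_of_nonneg_left ?_ (by positivity)
          have h1 : Real.log (2 * x) * M ≤ 2 * μ * L * M := mul_le_mul_of_nonneg_right hlog2x hM0
          have h2 : Real.log (2 * x) * (x / T) * (3 * (1 + Real.log (2 * x + 1))) ≤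
              2 * μ * L * (x / T) * (3 * (4 * μ * L)) := by
            refine mul_le_mul (mul_le_mul_of_nonneg_right hlog2x hxT) (by linarith) ?_ (by positivity)
            have : 0 ≤ Real.log (2 * x + 1) := Real.log_nonneg (by linarith)
            positivity
          linarith
      _ = 8 * γ * μ * (L * M) + 48 * γ * μ ^ 2 * P := by rw [hP]; ring
  -- (6) summation
  have hbound : ∀ s : Finset ℕ, ∑ n ∈ s, g n ≤ C * (L * M + P) := by
    intro s
    have : ∑ n ∈ s, g n = ∑ n ∈ s, Λ n * e₁ n + ∑ n ∈ s, Λ n * e₂ n + ∑ n ∈ s, Λ n * e₃ n := by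
      rw [← Finset.sum_add_distrib, ← Finset.sum_add_distrib]
      refine Finset.sum_congr rfl fun n _ ↦ ?_
      simp only [hg]; ring
    rw [this]
    have hLM : 0 ≤ L * M := by positivity
    have h := add_le_add (add_le_add (hS1 s) (hS2 s)) (hS3 s)
    refine h.trans ?_
    rw [hC]
    have hγ0 : 0 ≤ γ := by positivity
    nlinarith [mul_nonneg hγ0 hLM, mul_nonneg (by positivity : (0:ℝ) ≤ A₁) hLM,
      mul_nonneg (by positivity : (0:ℝ) ≤ μ ^ 2) hLM, mul_nonneg (by positivity : (0:ℝ) ≤ γ * μ) hP0,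
      mul_nonneg (by positivity : (0:ℝ) ≤ γ * μ ^ 2) hLM]
  have hgsum : Summable g := summable_of_sum_le hg0 hbound
  have hgtsum : ∑' n, g n ≤ C * (L * M + P) := Real.tsum_le_of_sum_le hg0 hbound
  have hmain := (hDCT.sub hindsum).norm_le_of_bounded hgsum.hasSum herr
  exact hmain.trans hgtsum

end ExplicitPsiChar

end Literature.NumberTheory.LFunctions

end
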